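import Literature.Geometry.Lorentzian.KerrDataConstraints
import Literature.Geometry.Lorentzian.KerrStationaryBlackHole
import HarnessLib

/-!
# The Kerr–Schild slice as a vacuum data embedding of the Kerr data

The slice embedding `y ↦ (0, y)` of `Kerr.slice a r₀` into the time-oriented Kerr–Schild chart
`Kerr.spacetime M a r₀ hM` (`Kerr.region a r₀`, `g = η + 2H ℓ ⊗ ℓ`, time orientation `−g♯dt*`),
together with the future unit normal `ν = (1 + 2H)^{-1/2} V`, is a `DataEmbedding`
(`CauchyDevelopment.lean`; Ringström 2009, Def. 16.2) of the Kerr initial data set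
`Kerr.data M a r₀ hM`: every field is a theorem of the tree (`Kerr.isSmoothEmbedding_sliceEmbed_holds`,
`Kerr.isFutureUnitNormal_sliceNormal_holds`; `ι^* g = h` and `K_ν = k` hold by the definition of
`Kerr.data`). Since the Kerr metric is Ricci-flat for every spin (`Kerr.ricci_smoothMetric`,
`KerrRicciFlat.lean`), it is a **vacuum** data embedding (so that, e.g., the necessity of the constraints
`InitialDataSet.isVacuumConstraintSolution_of_isVacuum`, Choquet-Bruhat 2009, Ch. VI, Thm. 3.3, applies
to it; cf. `Kerr.isVacuumConstraintSolution_data`). (It is *not* a Cauchy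
development: the slice is not a Cauchy hypersurface of the chart, `KerrData.lean`, review F5.)

* `Kerr.dataEmbedding`, with the `rfl` lemmas `dataEmbedding_carrier`, `_metric`, `_embed`,
  `_normal`, `_timeOrientation`;
* `Kerr.dataEmbedding_isVacuum`.

Everything is proved; no named facts.

## References

* H. Ringström, *The Cauchy Problem in General Relativity*, EMS 2009, Def. 16.2–16.3.
* Y. Choquet-Bruhat, *General Relativity and the Einstein Equations*, OUP 2009, Ch. VI, Thm. 3.3.
* R. P. Kerr, A. Schild, *A new class of vacuum solutions of the Einstein field equations*, 1965, §3.
-/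

noncomputable section

open Bundle TopologicalSpace Manifold Set Module
open scoped ContDiff Topology Manifold

namespace Literature.Geometry.Lorentzian

namespace Kerr

/-! ### The slice as a vacuum data embedding -/

/-- **The Kerr–Schild slice as a data embedding** of `Kerr.data M a r₀ hM` (`M ≥ 0`): the
time-oriented Kerr chart `Kerr.spacetime M a r₀ hM` (`Kerr.region a r₀`, `g = η + 2H ℓ ⊗ ℓ`,
time orientation `−g♯dt*`), the smooth embedding `ι = Kerr.sliceEmbed` (`y ↦ (0, y)`,
`Kerr.isSmoothEmbedding_sliceEmbed_holds`) and the future unit normal `ν = Kerr.sliceNormal`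
(`Kerr.isFutureUnitNormal_sliceNormal_holds`); `ι^* g = h` and `K_ν = k` hold by definition of
`Kerr.data`. (Not a Cauchy development: the slice is not a Cauchy hypersurface of the chart.)
Ringström 2009, Def. 16.2; Dafermos–Rodnianski arXiv:0811.0354, §5.1. [cite: Ringstrom2009, Def. 16.2] -/
def dataEmbedding [Facts] [SliceFacts] (M a r₀ : ℝ) (hM : 0 ≤ M) : DataEmbedding (data M a r₀ hM) where
  toSpacetime := spacetime M a r₀ hM
  embed := sliceEmbed a r₀
  isSmoothEmbedding := isSmoothEmbedding_sliceEmbed_holds a r₀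
  normal := sliceNormal M a r₀
  isFutureUnitNormal := isFutureUnitNormal_sliceNormal_holds M a r₀ hM
  induced_h := fun _ ↦ rfl
  induced_k := fun _ ↦ rfl

/-- The carrier of `Kerr.dataEmbedding` is the Kerr chart `Kerr.region a r₀` (by `rfl`).
Dafermos–Rodnianski arXiv:0811.0354, §5.1. [cite: arXiv08110354, §5.1] -/
theorem dataEmbedding_carrier [Facts] [SliceFacts] (M a r₀ : ℝ) (hM : 0 ≤ M) :
    (dataEmbedding M a r₀ hM).carrier = region a r₀ := rfl

/-- The metric of `Kerr.dataEmbedding` is the smooth Kerr metric (by `rfl`).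
Kerr–Schild 1965, §3. [cite: KerrSchild1965, §3] -/
theorem dataEmbedding_metric [Facts] [SliceFacts] (M a r₀ : ℝ) (hM : 0 ≤ M) :
    (dataEmbedding M a r₀ hM).metric = smoothMetric M a r₀ := rfl

/-- The embedding of `Kerr.dataEmbedding` is `Kerr.sliceEmbed` (by `rfl`).
Dafermos–Rodnianski arXiv:0811.0354, §5.1. [cite: arXiv08110354, §5.1] -/
theorem dataEmbedding_embed [Facts] [SliceFacts] (M a r₀ : ℝ) (hM : 0 ≤ M) :
    (dataEmbedding M a r₀ hM).embed = sliceEmbed a r₀ := rfl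

/-- The normal of `Kerr.dataEmbedding` is `Kerr.sliceNormal` (by `rfl`). Cook 2000, §3.2.2.
[cite: Cook2000, §3.2.2] -/
theorem dataEmbedding_normal [Facts] [SliceFacts] (M a r₀ : ℝ) (hM : 0 ≤ M) :
    (dataEmbedding M a r₀ hM).normal = sliceNormal M a r₀ := rfl

/-- The time orientation of `Kerr.dataEmbedding` is the Kerr one, `−g♯dt*`, at `C^∞` regularity
(by `rfl`). Dafermos–Rodnianski arXiv:0811.0354, §5.1. [cite: arXiv08110354, §5.1] -/
theorem dataEmbedding_timeOrientation [Facts] [SliceFacts] (M a r₀ : ℝ) (hM : 0 ≤ M) :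
    (dataEmbedding M a r₀ hM).timeOrientation = (timeOrientation M a r₀ hM).ofLE le_top := rfl

/-- **The Kerr–Schild slice embedding is a vacuum data embedding**: `Ric(g_{M,a}) = 0` on the Kerr
chart for every proof of the Levi-Civita hypothesis (`Kerr.ricci_smoothMetric`, all spins).
Kerr–Schild 1965, §3; Ringström 2009, Def. 16.3. [cite: KerrSchild1965, §3] -/
theorem dataEmbedding_isVacuum [Facts] [SliceFacts] (M a r₀ : ℝ) (hM : 0 ≤ M) :
    (dataEmbedding M a r₀ hM).IsVacuum :=
  fun x ↦ ricci_smoothMetric M a r₀ x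

end Kerr

end Literature.Geometry.Lorentzian

end
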